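import Summits.AtomisticToContinuum.Crystallization.Theorems.ExcessDecayLiouvilleRelaxationCrossFC

/-!
# Route `ExcessDecayLiouville`: coercivity of the cross force-constant operator (relaxation, II)

Harmonic-replacement architecture for item `ExcessDecay` (stmt-AtomisticToContinuum-9334), nonlinear half.
With the cross force-constant operator `M = Σ'_{q ∈ S₁} K(t 0 − q)` and the optical test field
`u = η · 𝟙_{S₀} · β` of `ExcessDecayLiouvilleRelaxationCrossFC.lean`, the harmonic-stability hypothesis
`κ · nnForm v ≤ Σ' ⟪L v, v⟫` (`κ > 0`) yields `⟪Mβ, β⟫ ≥ (κ/2)‖β‖²` (`crossFC_coercive`): the rows of `u` are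
`η_p · Mβ` plus an `O(1/L)` commutator, the strain form of `u` counts one cross neighbour per site, a lattice
box gives the lower site count (`box_count_le`) and the packing bound the upper one; take `L ~ C/κ`.
All `[folklore]`; helper lemmas, nothing here closes an item.
-/

noncomputable section

namespace Summit.AtomisticToContinuum.Crystallization.Theorems.ExcessDecayLiouville

open scoped BigOperators Topology InnerProductSpace RealInnerProductSpace Classical
open Literature.MathematicalPhysics.StatisticalMechanics
open Summit.AtomisticToContinuum.Crystallization.Theorems.PhononStabilityNegative

local notation "E3" => EuclideanSpace ℝ (Fin 3)

-- Local notation: the force-constant map `K(e)w = h(|e|²)w + 2⟪e,w⟫h′(|e|²)e` (`= forceConst e w`).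
local notation3 "𝕂[" e "] " w:max =>
  (-((‖e‖ ^ 2)⁻¹) ^ 7 + ((‖e‖ ^ 2)⁻¹) ^ 4) • w + (2 * ⟪e, w⟫ * (7 * ((‖e‖ ^ 2)⁻¹) ^ 8 - 4 * ((‖e‖ ^ 2)⁻¹) ^ 5)) • e

section

variable {t : Fin 2 → E3} {A : E3 →L[ℝ] E3} {κ : ℝ}

set_option quotPrecheck false in
-- Local notation: the operator row `(L v)(p)`.
local notation "𝕃" v:max " @ " p:max =>
  tsum (fun q : Sites₀ t A => (if ((p : Sites₀ t A) : E3) ≠ q then 𝕂[((p : Sites₀ t A) : E3) - q] (v ((p : Sites₀ t A) : E3) - v q) else 0))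

set_option quotPrecheck false in
-- Local notation: the cross force-constant operator `M = Σ'_{q ∈ S₁} K(t 0 − q)`.
local notation "𝐌ₓ" =>
  tsum (fun q : Sites₀ t A => (if (∃ z ∈ Λ₀, (q : E3) = t 1 + A z) then forceConst ((t 0 : E3) - q) else 0))

/-! ## Site counts and the cut-off -/

/-- **A lattice box gives the lower site count**: if `g ≥ 0` on the sites, `g ≥ 1` at the sites of sublattice `0`
within `4n` of `t 0`, and `T` contains all sites within `4n` of `t 0`, then `(2n+1)³ ≤ Σ_{p ∈ T} g p`. [folklore] -/
theorem box_count_le (hA : Adm₀ A) (n : ℕ) (g : Sites₀ t A → ℝ) (hg : ∀ p, 0 ≤ g p)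
    (T : Finset (Sites₀ t A)) (hT : ∀ p : Sites₀ t A, dist (p : E3) (t 0) ≤ 4 * n → p ∈ T)
    (hg1 : ∀ p : Sites₀ t A, (∃ z ∈ Λ₀, (p : E3) = t 0 + A z) → dist (p : E3) (t 0) ≤ 4 * n → 1 ≤ g p) :
    ((2 * n + 1) ^ 3 : ℝ) ≤ ∑ p ∈ T, g p := by
  classical
  set box : Finset (ℤ × ℤ × ℤ) := (Finset.Icc (-(n : ℤ)) n) ×ˢ (Finset.Icc (-(n : ℤ)) n) ×ˢ (Finset.Icc (-(n : ℤ)) n)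
    with hbox
  -- the box map into the sites
  let zv : ℤ × ℤ × ℤ → E3 := fun ijk => ((ijk.1 : ℤ) : ℝ) • (triangularVec₁ 1 : E3) + ((ijk.2.1 : ℤ) : ℝ) • triangularVec₂ 1 +
    ((ijk.2.2 : ℤ) : ℝ) • layerNormal (2 * Real.sqrt (2 / 3))
  have hzv : ∀ ijk, zv ijk ∈ Λ₀ := fun ijk => latticeVec_mem_Λ₀ _ _ _
  let f : ℤ × ℤ × ℤ → Sites₀ t A := fun ijk => ⟨t 0 + A (zv ijk), 0, zv ijk, hzv ijk, rfl⟩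
  have hf : ∀ ijk, ((f ijk : Sites₀ t A) : E3) = t 0 + A (zv ijk) := fun _ => rfl
  -- distances
  have hA1 : ‖A‖ ≤ 1 := (norm_le_of_adm₀ hA).trans (by norm_num)
  have hdist : ∀ ijk ∈ box, dist ((f ijk : Sites₀ t A) : E3) (t 0) ≤ 4 * n := by
    intro ijk hijk
    simp only [hbox, Finset.mem_product, Finset.mem_Icc] at hijk
    obtain ⟨⟨h1, h2⟩, ⟨h3, h4⟩, ⟨h5, h6⟩⟩ := hijk
    rw [hf, dist_eq_norm, add_sub_cancel_left]
    have hz := norm_latticeVec_le ijk.1 ijk.2.1 ijk.2.2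
    have hi : |((ijk.1 : ℤ) : ℝ)| ≤ n := by rw [← Int.cast_abs]; exact_mod_cast abs_le.2 ⟨h1, h2⟩
    have hj : |((ijk.2.1 : ℤ) : ℝ)| ≤ n := by rw [← Int.cast_abs]; exact_mod_cast abs_le.2 ⟨h3, h4⟩
    have hk : |((ijk.2.2 : ℤ) : ℝ)| ≤ n := by rw [← Int.cast_abs]; exact_mod_cast abs_le.2 ⟨h5, h6⟩
    calc ‖A (zv ijk)‖ ≤ ‖A‖ * ‖zv ijk‖ := A.le_opNorm _
      _ ≤ 1 * (4 * n) := mul_le_mul hA1 (by simp only [zv]; linarith) (norm_nonneg _) zero_le_one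
      _ = 4 * n := one_mul _
  -- injectivity
  have hinj : Set.InjOn f box := by
    intro a _ b _ hab
    have h1 : A (zv a) = A (zv b) := by
      have := congrArg (fun q : Sites₀ t A => (q : E3)) hab
      simpa [hf] using this
    have h2 : A (zv (a.1 - b.1, a.2.1 - b.2.1, a.2.2 - b.2.2)) = 0 := by
      have e : zv a = zv (a.1 - b.1, a.2.1 - b.2.1, a.2.2 - b.2.2) + zv b := by
        simp only [zv]
        have := latticeVec_add (a.1 - b.1) (a.2.1 - b.2.1) (a.2.2 - b.2.2) b.1 b.2.1 b.2.2
        simp only [sub_add_cancel] at this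
        exact this
      rw [e, map_add] at h1
      simpa using h1
    obtain ⟨hi, hj, hk⟩ := abs_coord_le_norm_apply_latticeVec hA (a.1 - b.1) (a.2.1 - b.2.1) (a.2.2 - b.2.2)
    simp only [zv] at h2
    rw [h2, norm_zero, mul_zero] at hi hj hk
    have e1 : a.1 = b.1 := by
      have : (a.1 - b.1 : ℤ) = 0 := by exact_mod_cast (abs_nonpos_iff.1 hi)
      exact sub_eq_zero.1 this
    have e2 : a.2.1 = b.2.1 := by
      have : (a.2.1 - b.2.1 : ℤ) = 0 := by exact_mod_cast (abs_nonpos_iff.1 hj)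
      exact sub_eq_zero.1 this
    have e3 : a.2.2 = b.2.2 := by
      have : (a.2.2 - b.2.2 : ℤ) = 0 := by exact_mod_cast (abs_nonpos_iff.1 hk)
      exact sub_eq_zero.1 this
    exact Prod.ext e1 (Prod.ext e2 e3)
  have himg : box.image f ⊆ T := by
    intro p hp
    rw [Finset.mem_image] at hp
    obtain ⟨ijk, hijk, rfl⟩ := hp
    exact hT _ (hdist ijk hijk)
  have hcard : ((2 * n + 1) ^ 3 : ℝ) = ∑ ijk ∈ box, (1 : ℝ) := by
    rw [Finset.sum_const, nsmul_eq_mul, mul_one, hbox, card_latticeBox]; push_cast; ring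
  calc ((2 * n + 1) ^ 3 : ℝ) = ∑ ijk ∈ box, (1 : ℝ) := hcard
    _ ≤ ∑ ijk ∈ box, g (f ijk) := Finset.sum_le_sum fun ijk hijk =>
        hg1 _ ⟨zv ijk, hzv ijk, hf ijk⟩ (hdist ijk hijk)
    _ = ∑ p ∈ box.image f, g p := (Finset.sum_image hinj).symm
    _ ≤ ∑ p ∈ T, g p := Finset.sum_le_sum_of_subset_of_nonneg himg fun p _ _ => hg p

/-- A Lipschitz site cut-off at scale `L`: `η = 1` on the sites of `B_L(t 0)`, `η = 0` beyond `2L`,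
`0 ≤ η ≤ 1`, `|η p − η q| ≤ ‖p − q‖/L`. [folklore] -/
theorem exists_cutoff {L : ℝ} (hL : 0 < L) :
    ∃ η : E3 → ℝ, (∀ x, 0 ≤ η x ∧ η x ≤ 1) ∧ (∀ x ∈ Sites₀ t A, dist x (t 0) ≤ L → η x = 1) ∧
      (∀ x, L + L ≤ dist x (t 0) → η x = 0) ∧
      (∀ p q : Sites₀ t A, |η p - η q| ≤ ‖(p : E3) - q‖ / L) := by
  refine ⟨fun x => if x ∈ Sites₀ t A then max (min 1 ((L + L - dist x (t 0)) / L)) 0 else 0,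
    fun x => ⟨siteCutoff_nonneg (t := t) (A := A) (t 0) L L x, siteCutoff_le_one (t := t) (A := A) (t 0) L L x⟩,
    fun x hx hxd => siteCutoff_eq_one (t := t) (A := A) hL hx hxd,
    fun x hxd => siteCutoff_eq_zero_of_le (t := t) (A := A) hL hxd,
    fun p q => abs_siteCutoff_sub_le (t := t) (A := A) hL p q⟩

/-! ## Coercivity of the cross force-constant operator -/

/-- **Coercivity of the cross force-constant operator.**  Under the harmonic-stability hypothesis
`κ · nnForm v ≤ Σ'_p ⟪(L v)(p), v p⟫` (`κ > 0`), `⟪Mβ, β⟫ ≥ (κ/2) ‖β‖²` for every `β`: the optical modes of an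
admissible hcp-like datum are uniformly stable. [folklore] -/
theorem crossFC_coercive (hA : Adm₀ A) (hI : Inner₀ t A) (hκ0 : 0 < κ)
    (hκ : ∀ v : E3 → E3, (Function.support v).Finite → Function.support v ⊆ Sites₀ t A →
      κ * nnForm t A v ≤ ∑' p : Sites₀ t A, ⟪𝕃 v @ p, v p⟫) (β : E3) :
    κ / 2 * ‖β‖ ^ 2 ≤ ⟪(𝐌ₓ) β, β⟫ := by
  -- constants: `C₇`, the box size `n`, the scale `L = 4n`
  set C₇ : ℝ := 1024 / ((23 / 25 : ℝ) ^ 3 * (23 / 25 : ℝ) ^ 4) with hC₇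
  have hC₇0 : 0 < C₇ := by positivity
  set n : ℕ := ⌈38912 * C₇ / κ⌉₊ + 1 with hn
  have hn1 : (1 : ℝ) ≤ n := by rw [hn]; push_cast; linarith [Nat.cast_nonneg (α := ℝ) ⌈38912 * C₇ / κ⌉₊]
  have hnκ : 38912 * C₇ ≤ (n : ℝ) * κ := by
    have h1 : 38912 * C₇ / κ ≤ n := by
      rw [hn]; push_cast
      exact (Nat.le_ceil _).trans (by linarith)
    rwa [div_le_iff₀ hκ0] at h1
  have hL0 : (0 : ℝ) < 4 * n := by positivity
  obtain ⟨η, hη01, hη1, hη0, hηL⟩ := exists_cutoff (t := t) (A := A) hL0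
  have hηabs : ∀ x, |η x| ≤ 1 := fun x => abs_le.2 ⟨by linarith [(hη01 x).1], (hη01 x).2⟩
  -- the test field and its support
  have hsuppS : (Function.support fun x : E3 => if (∃ z ∈ Λ₀, x = t 0 + A z) then η x • β else 0) ⊆ Sites₀ t A := by
    intro x hx
    rw [Function.mem_support] at hx
    by_cases h : ∃ z ∈ Λ₀, x = t 0 + A z
    · obtain ⟨z, hz, rfl⟩ := h; exact ⟨0, z, hz, rfl⟩
    · exact absurd (by rw [if_neg h]) hx
  have hfin : (Function.support fun x : E3 => if (∃ z ∈ Λ₀, x = t 0 + A z) then η x • β else 0).Finite := by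
    refine (finite_sites_dist_le hA hI (t 0) (4 * n + 4 * n)).subset fun x hx => ⟨hsuppS hx, ?_⟩
    rw [Function.mem_support] at hx
    by_contra hd
    have h0 := hη0 x (not_le.1 hd).le
    apply hx
    split_ifs
    · rw [h0, zero_smul]
    · rfl
  have hκu := hκ _ hfin hsuppS
  -- the finite set of sites within `8n` of `t 0`
  set T : Finset (Sites₀ t A) := ((finite_sites_dist_le hA hI (t 0) (4 * n + 4 * n)).toFinset).subtype (· ∈ Sites₀ t A)
    with hT
  have hTmem : ∀ p : Sites₀ t A, p ∈ T ↔ dist (p : E3) (t 0) ≤ 4 * n + 4 * n := by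
    intro p
    rw [hT, Finset.mem_subtype, Set.Finite.mem_toFinset]
    exact ⟨fun h => h.2, fun h => ⟨p.2, h⟩⟩
  have hzero : ∀ p : Sites₀ t A, p ∉ T →
      (fun x : E3 => if (∃ z ∈ Λ₀, x = t 0 + A z) then η x • β else 0) (p : E3) = 0 := by
    intro p hp
    rw [hTmem, not_le] at hp
    have h0 := hη0 p hp.le
    simp only []
    split_ifs
    · rw [h0, zero_smul]
    · rfl
  -- the right-hand side as a finite sum, row by row
  have hR : (∑' p : Sites₀ t A, ⟪𝕃 (fun x : E3 => if (∃ z ∈ Λ₀, x = t 0 + A z) then η x • β else 0) @ p,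
      (fun x : E3 => if (∃ z ∈ Λ₀, x = t 0 + A z) then η x • β else 0) (p : E3)⟫) =
      ∑ p ∈ T, ⟪𝕃 (fun x : E3 => if (∃ z ∈ Λ₀, x = t 0 + A z) then η x • β else 0) @ p,
        (fun x : E3 => if (∃ z ∈ Λ₀, x = t 0 + A z) then η x • β else 0) (p : E3)⟫ :=
    tsum_eq_sum fun p hp => by rw [hzero p hp, inner_zero_right]
  have hrowle : ∀ p ∈ T, ⟪𝕃 (fun x : E3 => if (∃ z ∈ Λ₀, x = t 0 + A z) then η x • β else 0) @ p,
      (fun x : E3 => if (∃ z ∈ Λ₀, x = t 0 + A z) then η x • β else 0) (p : E3)⟫ ≤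
      (if (∃ z ∈ Λ₀, (p : E3) = t 0 + A z) then (η p) ^ 2 else 0) * ⟪(𝐌ₓ) β, β⟫ +
        38 / (4 * n) * C₇ * ‖β‖ ^ 2 := by
    intro p _
    have hrest : 0 ≤ 38 / (4 * n) * C₇ * ‖β‖ ^ 2 := by positivity
    by_cases hp : ∃ z ∈ Λ₀, (p : E3) = t 0 + A z
    · rw [opRow_testField hA hI η hηabs β p hp, if_pos hp]
      obtain ⟨zp, hzp, hpz⟩ := hp
      have hV : (∑' q : Sites₀ t A, (if (∃ z ∈ Λ₀, (q : E3) = t 1 + A z) then 𝕂[(p : E3) - q] β else 0)) = (𝐌ₓ) β := by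
        rw [hpz]; exact crossRow_eq hA hI β hzp
      have hC := norm_commRow_le hA hI η hL0 hηL β p
      rw [hV]
      simp only []
      rw [if_pos ⟨zp, hzp, hpz⟩, inner_add_left, real_inner_smul_left, real_inner_smul_right, real_inner_smul_right]
      have hin : η p * ⟪∑' q : Sites₀ t A, (if ((p : E3) ≠ q ∧ ∃ z ∈ Λ₀, (q : E3) = t 0 + A z) then
          (η p - η q) • 𝕂[(p : E3) - q] β else 0), β⟫ ≤ 38 / (4 * n) * C₇ * ‖β‖ ^ 2 := by
        refine (le_abs_self _).trans ?_
        rw [abs_mul]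
        calc |η p| * |⟪∑' q : Sites₀ t A, (if ((p : E3) ≠ q ∧ ∃ z ∈ Λ₀, (q : E3) = t 0 + A z) then
              (η p - η q) • 𝕂[(p : E3) - q] β else 0), β⟫|
            ≤ 1 * (38 / (4 * n) * C₇ * ‖β‖ * ‖β‖) :=
              mul_le_mul (hηabs p) ((abs_real_inner_le_norm _ _).trans (mul_le_mul_of_nonneg_right hC (norm_nonneg _)))
                (abs_nonneg _) zero_le_one
          _ = 38 / (4 * n) * C₇ * ‖β‖ ^ 2 := by ring
      nlinarith [hin]
    · simp only []
      rw [if_neg hp, if_neg hp, inner_zero_right, zero_mul, zero_add]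
      exact hrest
  -- summing the rows
  have hRle : ∑ p ∈ T, ⟪𝕃 (fun x : E3 => if (∃ z ∈ Λ₀, x = t 0 + A z) then η x • β else 0) @ p,
      (fun x : E3 => if (∃ z ∈ Λ₀, x = t 0 + A z) then η x • β else 0) (p : E3)⟫ ≤
      (∑ p ∈ T, (if (∃ z ∈ Λ₀, (p : E3) = t 0 + A z) then (η p) ^ 2 else 0)) * ⟪(𝐌ₓ) β, β⟫ +
        T.card * (38 / (4 * n) * C₇ * ‖β‖ ^ 2) := by
    refine (Finset.sum_le_sum hrowle).trans ?_
    rw [Finset.sum_add_distrib, Finset.sum_mul, Finset.sum_const, nsmul_eq_mul]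
  -- the left-hand side
  have hLge := nnForm_testField_ge hA hI η β hfin T
  have hLeq : ∑ p ∈ T, ‖(fun x : E3 => if (∃ z ∈ Λ₀, x = t 0 + A z) then η x • β else 0) (p : E3)‖ ^ 2 =
      (∑ p ∈ T, (if (∃ z ∈ Λ₀, (p : E3) = t 0 + A z) then (η p) ^ 2 else 0)) * ‖β‖ ^ 2 := by
    rw [Finset.sum_mul]
    refine Finset.sum_congr rfl fun p _ => ?_
    simp only []
    split_ifs
    · rw [norm_smul, mul_pow, Real.norm_eq_abs, sq_abs]
    · rw [norm_zero]; ring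
  -- the count bounds
  generalize hW : (∑ p ∈ T, (if (∃ z ∈ Λ₀, (p : E3) = t 0 + A z) then (η p) ^ 2 else 0)) = W at hRle hLeq
  have hWge : ((2 * n + 1) ^ 3 : ℝ) ≤ W := by
    rw [← hW]
    refine box_count_le hA n _ (fun p => by positivity) T (fun p hp => (hTmem p).2 (by linarith)) ?_
    intro p hp hpd
    rw [if_pos hp, hη1 p p.2 hpd]; norm_num
  have hTcard : (T.card : ℝ) ≤ 32 * (4 * n + 4 * n) ^ 3 :=
    LevelOne.card_sites_le hA hI (t 0) (by linarith) T fun q hq => (hTmem q).1 hq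
  -- assembling
  generalize hm : ⟪(𝐌ₓ) β, β⟫ = m at hRle
  have hW0 : 0 < W := lt_of_lt_of_le (by positivity) hWge
  have key : κ * (W * ‖β‖ ^ 2) ≤ W * m + T.card * (38 / (4 * n) * C₇ * ‖β‖ ^ 2) := by
    have h1 := mul_le_mul_of_nonneg_left hLge hκ0.le
    rw [hLeq] at h1
    exact h1.trans (hκu.trans (by rw [hR]; exact hRle))
  have hcount : (T.card : ℝ) * (38 / (4 * n) * C₇) ≤ W * (κ / 2) := by
    have hn0 : (0 : ℝ) < n := by linarith
    have h1 : (T.card : ℝ) * (38 / (4 * n) * C₇) ≤ 32 * (4 * n + 4 * n) ^ 3 * (38 / (4 * n) * C₇) :=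
      mul_le_mul_of_nonneg_right hTcard (by positivity)
    have h2 : 32 * (4 * (n : ℝ) + 4 * n) ^ 3 * (38 / (4 * n) * C₇) = 155648 * (n : ℝ) ^ 2 * C₇ := by
      field_simp; ring
    have h3 : (8 : ℝ) * (n : ℝ) ^ 3 ≤ (2 * n + 1) ^ 3 := by nlinarith [hn0]
    have h4 : 155648 * (n : ℝ) ^ 2 * C₇ ≤ 8 * (n : ℝ) ^ 3 * (κ / 2) :=
      calc 155648 * (n : ℝ) ^ 2 * C₇ = 4 * (n : ℝ) ^ 2 * (38912 * C₇) := by ring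
        _ ≤ 4 * (n : ℝ) ^ 2 * ((n : ℝ) * κ) := by gcongr
        _ = 8 * (n : ℝ) ^ 3 * (κ / 2) := by ring
    calc (T.card : ℝ) * (38 / (4 * n) * C₇) ≤ 155648 * (n : ℝ) ^ 2 * C₇ := by rw [← h2]; exact h1
      _ ≤ 8 * (n : ℝ) ^ 3 * (κ / 2) := h4
      _ ≤ W * (κ / 2) := by gcongr; exact h3.trans hWge
  have key2 : W * (κ / 2 * ‖β‖ ^ 2) ≤ W * m := by
    have hb : 0 ≤ ‖β‖ ^ 2 := by positivity
    nlinarith [key, mul_le_mul_of_nonneg_right hcount hb]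
  exact le_of_mul_le_mul_left key2 hW0

end

end Summit.AtomisticToContinuum.Crystallization.Theorems.ExcessDecayLiouville

end
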